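import Literature.AlgebraicGeometry.Frobenioids.ArithmeticFrobenioidThm64ivNormPreservation
import Literature.AlgebraicGeometry.Frobenioids.NNRealConeAddEquivMonomial
import Literature.NumberTheory.NumberFields.PrincipalDivisorTransportGalois
import HarnessLib

/-!
# Frobenioids I, Theorem 6.4 (iv) AT THE CONSTRUCTIONS: the archimedean component of `Ψ^Φ` is a bijection of
# infinite places which, read through `L₁ ≅ L₂`, is induced by an element of `Gal(L₁/ℚ)`

Mochizuki, *The geometry of Frobenioids I: the general theory*, Kyushu J. Math. **62** (2008) 293–400, §6,
Thm. 6.4 (iv) p. 115 l. 23–29 (the clause «is isomorphic to `L₁` in a fashion that is compatible with an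
isomorphism `F₁ ⥲ F₂`») [cite: MochizukiFrdI2008, Thm. 6.4 (iv) p.115].

PROOF-ONLY file (cell abc-iut, layer L1, seat abc-iut-L1-d3 gen 4; GAP-LEDGER G-L1t3-1 #2 general case —
supplement to abc-iut-w4-d090's row; 0 definitions, no named facts).  For an equivalence
`Ψ : C_{K₁/F₁} ⥲ C_{K₂/F₂}` of THE arithmetic Frobenioids with its Cor. 4.11 (iv) datum `(Ψ^Base, Ψ^Φ = E, η, hdiv)`
and `X = Spec L₁` with `L₁` Galois over `ℚ`, `L₂ := (Ψ^Base X).L`: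
* `arith_archTransport` — the archimedean component of the monoid isomorphism `Ψ^Φ_X : Φ(L₁) ⥲ Φ(L₂)` is a
  BIJECTION `π_∞ : V(L₁)^arc ≃ V(L₂)^arc` relabelling coordinates (`(Ψ^Φ_X D)(π_∞ v) = D(v)`): an additive bijection of
  the archimedean cones is monomial (`NNRealPi.exists_equiv_map_single`, p435390) and its scalings are `1` by degree
  transport (abc-iut-L1-d7's `exists_arithDegree_comp_eq_mul` + `arith_logNorm_transport`, all local degrees of a
  Galois field being equal); `π_∞` is EQUIVARIANT: `π_∞ (v ∘ h) = (π_∞ v) ∘ Ψ^Base(h)` for `h ∈ Aut_{D₁}(X)` (naturality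
  of `Ψ^Φ`);
* `arith_archTransport_galois` — for ANY field isomorphism `e : L₁ ≅ L₂` there is `s ∈ Gal(L₁/ℚ)` with
  `(π_∞ v) ∘ e = s • v` for all `v` (the core theorem `exists_algEquiv_forall_eq_smul` of
  `NumberFields/PrincipalDivisorTransportGalois` applied to `Γ := e^* ∘ (Ψ^Φ_X)^gp`, which relabels places and
  carries principal divisors to principal divisors by the `Φ^birat` clause `arith_biratCompat_of_cor411iv`).
Nothing here bears on, or takes a side on, [IUTchIII] Cor. 3.12.
-/

noncomputable section

namespace Literature.AlgebraicGeometry.Frobenioids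

open CategoryTheory Opposite NumberField NumberField.InfinitePlace
open Literature.NumberTheory.NumberFields

section Arith

variable {F₁ : Type} [Field F₁] [NumberField F₁] {K₁ : Type} [Field K₁] [Algebra F₁ K₁] [IsGalois F₁ K₁]
variable {F₂ : Type} [Field F₂] [NumberField F₂] {K₂ : Type} [Field K₂] [Algebra F₂ K₂] [IsGalois F₂ K₂]

/-- All infinite places of a Galois number field have the same local degree. [cite: MochizukiFrdI2008, Thm. 6.4 (iv) p.115] -/
theorem mult_eq_mult_of_isGalois {L : Type} [Field L] [NumberField L] [IsGalois ℚ L] (v v' : InfinitePlace L) :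
    v.mult = v'.mult := by
  obtain ⟨t, ht⟩ := exists_ringHom_eq_comp v'.embedding v.embedding
  have hv : v = t.symm • v' := by
    rw [← mk_embedding v, ht, ← mk_embedding v', smul_mk, mk_embedding, AlgEquiv.symm_symm]
  unfold InfinitePlace.mult
  rw [hv, isReal_smul_iff]

/-- **The archimedean component of `Ψ^Φ_X` is an equivariant bijection of infinite places** (at `X = Spec L₁`,
`L₁` Galois over `ℚ`): there is `π_∞ : V(L₁)^arc ≃ V(L₂)^arc` with `(Ψ^Φ_X D)(π_∞ v) = D(v)` for every effective
arithmetic divisor `D`, natural in `Aut_{D₁}(X)`, together with the groupified transport `(Ψ^Φ_X)^gp` relabelling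
finite places by the generator bijection `π` and carrying principal divisors to principal divisors.
[cite: MochizukiFrdI2008, Thm. 6.4 (iv) p.115] -/
theorem arith_archTransport (Ψ : arithFrobenioid F₁ K₁ ≌ arithFrobenioid F₂ K₂)
    {ΨBase : FinSubextCat F₁ K₁ ⥤ FinSubextCat F₂ K₂} [ΨBase.IsEquivalence]
    (E : PreFrobenioidData.DivisorMonoidIsoOverBase (arithFrobenioidOps F₁ K₁) (arithFrobenioidOps F₂ K₂) ΨBase)
    (η : Ψ.functor ⋙ (arithFrobenioidOps F₂ K₂).base ≅ (arithFrobenioidOps F₁ K₁).base ⋙ ΨBase)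
    (hdiv : ∀ ⦃A B : arithFrobenioid F₁ K₁⦄ (φ : A ⟶ B),
      (arithFrobenioidOps F₂ K₂).div (Ψ.functor.map φ) =
        (arithFrobenioidOps F₂ K₂).pull (η.hom.app A)
          (E.iso ((arithFrobenioidOps F₁ K₁).base.obj A) ((arithFrobenioidOps F₁ K₁).div φ)))
    (X : FinSubextCat F₁ K₁) (hX : IsGalois ℚ X.L) (e : X.L ≃+* (ΨBase.obj X).L) :
    ∃ (π : FinitePlace X.L ≃ FinitePlace (ΨBase.obj X).L)
      (πi : InfinitePlace X.L ≃ InfinitePlace (ΨBase.obj X).L)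
      (eG : ArithDivisor X.L →+ ArithDivisor (ΨBase.obj X).L),
      (∀ w, E.iso X (Multiplicative.ofAdd (EffArithDivisor.single X.L (Sum.inr w))) =
        Multiplicative.ofAdd (EffArithDivisor.single (ΨBase.obj X).L (Sum.inr (π w)))) ∧
      (∀ (D : EffArithDivisor X.L) (v : InfinitePlace X.L),
        (Multiplicative.toAdd (E.iso X (Multiplicative.ofAdd D))).2 (πi v) = D.2 v) ∧
      (∀ (h : X ⟶ X) (v : InfinitePlace X.L),
        πi (v.comap (h.toAlgHom : X.L →+* X.L)) =
          (πi v).comap ((ΨBase.map h).toAlgHom : (ΨBase.obj X).L →+* (ΨBase.obj X).L)) ∧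
      (∀ D : EffArithDivisor X.L, eG (EffArithDivisor.toArithDivisor X.L D) =
        EffArithDivisor.toArithDivisor (ΨBase.obj X).L (Multiplicative.toAdd (E.iso X (Multiplicative.ofAdd D)))) ∧
      (∀ (d : ArithDivisor X.L) (w : FinitePlace X.L), (eG d).1 (π w) = d.1 w) ∧
      (∀ (d : ArithDivisor X.L) (v : InfinitePlace X.L), (eG d).2 (πi v) = d.2 v) ∧
      (∀ u : (X.L)ˣ, ∃ y : ((ΨBase.obj X).L)ˣ,
        eG (principalArithDivisor X.L u) = principalArithDivisor (ΨBase.obj X).L y) := by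
  classical
  haveI := hX
  -- the decomposition `Ψ^Φ_X (f, t) = (π_* f, g t)` and the groupified transport `eG`
  let eM : Multiplicative (EffArithDivisor X.L) ≃* Multiplicative (EffArithDivisor (ΨBase.obj X).L) := E.iso X
  obtain ⟨π, g, hπ, hdec⟩ := EffArithDivisor.exists_decomposition_mulEquiv eM
  let eE : EffArithDivisor X.L →+ EffArithDivisor (ΨBase.obj X).L :=
    AddMonoidHom.toMultiplicative.symm eM.toMonoidHom
  let eG : ArithDivisor X.L →+ ArithDivisor (ΨBase.obj X).L :=
    AddMonoidHom.toMultiplicative.symm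
      ((EffArithDivisor.gpEquiv (ΨBase.obj X).L).toMonoidHom.comp
        ((MonGp.map eM.toMonoidHom).comp (EffArithDivisor.gpEquiv X.L).symm.toMonoidHom))
  have heG_apply : ∀ d : ArithDivisor X.L, eG d = Multiplicative.toAdd
      (EffArithDivisor.gpEquiv (ΨBase.obj X).L (MonGp.map eM.toMonoidHom
        ((EffArithDivisor.gpEquiv X.L).symm (Multiplicative.ofAdd d)))) := fun d => rfl
  have heE_apply : ∀ D : EffArithDivisor X.L, eE D = Multiplicative.toAdd (eM (Multiplicative.ofAdd D)) :=
    fun D => rfl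
  have heE_dec : ∀ D : EffArithDivisor X.L, eE D = (Finsupp.equivMapDomain π D.1, g D.2) := fun D => by
    rw [heE_apply, hdec, toAdd_ofAdd]
  have heG : ∀ D, eG (EffArithDivisor.toArithDivisor X.L D) =
      EffArithDivisor.toArithDivisor (ΨBase.obj X).L (eE D) := fun D => by
    rw [heG_apply, gpEquiv_symm_toArithDivisor, MonGp.map_of, EffArithDivisor.gpEquiv_apply,
      EffArithDivisor.gpHom_of, toAdd_ofAdd]
    rfl
  -- principal divisors go to principal divisors (the `Φ^birat` clause)
  have hB₂ : ∀ (A : (FinSubextCat F₂ K₂)ᵒᵖ) (b : (unitsFunctor F₂ K₂).obj A), IsUnit b := fun A b =>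
    (unitsFunctor_isGroupLike F₂ K₂ A.unop).isUnit b
  have hBC := arith_biratCompat_of_cor411iv Ψ E η hdiv X
  have hprinc : ∀ u : (X.L)ˣ, ∃ v : ((ΨBase.obj X).L)ˣ,
      eG (principalArithDivisor X.L u) = principalArithDivisor (ΨBase.obj X).L v := fun u => by
    have hmem : MonGp.map eM.toMonoidHom
        (divB (arithDivisorFunctor F₁ K₁) (unitsFunctor F₁ K₁) (divNatTrans F₁ K₁) (op X) u) ∈
          (PreFrobenioid.biratSubfunctor
            (ModelFrobenioid.toElem (arithDivisorFunctor F₂ K₂) (unitsFunctor F₂ K₂) (divNatTrans F₂ K₂))).carrier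
            (ΨBase.obj X) := by
      rw [← hBC]
      exact Subgroup.mem_map_of_mem _ (ModelFrobenioid.divB_mem_biratSubfunctor
        (fun A b => (unitsFunctor_isGroupLike F₁ K₁ A.unop).isUnit b) X u)
    rw [ModelFrobenioid.biratSubfunctor_carrier_eq hB₂ (ΨBase.obj X)] at hmem
    obtain ⟨v, hv⟩ : ∃ v : ((ΨBase.obj X).L)ˣ,
        divB (arithDivisorFunctor F₂ K₂) (unitsFunctor F₂ K₂) (divNatTrans F₂ K₂) (op (ΨBase.obj X)) v =
          MonGp.map eM.toMonoidHom
            (divB (arithDivisorFunctor F₁ K₁) (unitsFunctor F₁ K₁) (divNatTrans F₁ K₁) (op X) u) := hmem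
    refine ⟨v, ?_⟩
    rw [heG_apply, ← arith_divB_eq, ← hv, arith_divB_eq, MulEquiv.apply_symm_apply, toAdd_ofAdd]
  -- generator ↦ generator at the effective level, and the norm preservation `c = 1`
  have hπ' : ∀ w : FinitePlace X.L, eE (Finsupp.single w 1, 0) = (Finsupp.single (π w) 1, 0) := fun w => by
    rw [heE_apply, ← EffArithDivisor.single_inr X.L w, hπ, toAdd_ofAdd, EffArithDivisor.single_inr]
  obtain ⟨c, hc⟩ := exists_arithDegree_comp_eq_mul eG eE heG hprinc
  have hc1 : c = 1 := by
    haveI := infinite_finitePlace (L := X.L)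
    obtain ⟨w⟩ := (inferInstance : Nonempty (FinitePlace X.L))
    have h1 := hc (EffArithDivisor.toArithDivisor X.L (Finsupp.single w 1, 0))
    rw [heG, hπ', arithDegree_toArithDivisor_single, arithDegree_toArithDivisor_single,
      arith_logNorm_transport Ψ E η hdiv X π hπ w] at h1
    have hpos : 0 < logNorm w :=
      Real.log_pos (by exact_mod_cast NumberField.HeightOneSpectrum.one_lt_absNorm w.maximalIdeal)
    have : c * logNorm w = 1 * logNorm w := by rw [one_mul]; exact h1.symm
    exact mul_right_cancel₀ hpos.ne' this
  -- the archimedean part `g` preserves the (weighted, hence plain) coordinate sum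
  obtain ⟨v₀⟩ := (inferInstance : Nonempty (InfinitePlace X.L))
  have hm₁ : ∀ v : InfinitePlace X.L, (v.mult : ℝ) = v₀.mult := fun v => by
    rw [mult_eq_mult_of_isGalois v v₀]
  have hm₂ : ∀ w : InfinitePlace (ΨBase.obj X).L, (w.mult : ℝ) = v₀.mult := fun w => by
    have h1 : (w.comap (e : X.L →+* (ΨBase.obj X).L)).mult = w.mult := by
      unfold InfinitePlace.mult
      rw [isReal_comap_iff]
    rw [← h1, mult_eq_mult_of_isGalois _ v₀]
  have hsum : ∀ t : InfinitePlace X.L → NNReal, ∑ j, g t j = ∑ i, t i := by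
    intro t
    have h1 := hc (EffArithDivisor.toArithDivisor X.L (0, t))
    rw [hc1, one_mul, heG, heE_dec] at h1
    have e1 : EffArithDivisor.toArithDivisor (ΨBase.obj X).L
        ((Finsupp.equivMapDomain π (0 : FinitePlace X.L →₀ ℕ), g t) : EffArithDivisor (ΨBase.obj X).L) =
          ((0 : FinitePlace (ΨBase.obj X).L →₀ ℤ), fun w => ((g t w : NNReal) : ℝ)) := by
      refine Prod.ext (Finsupp.ext fun w => ?_) (funext fun w => ?_)
      · rw [EffArithDivisor.toArithDivisor_fst]
        simp
      · rw [EffArithDivisor.toArithDivisor_snd]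
    have e2 : EffArithDivisor.toArithDivisor X.L ((0, t) : EffArithDivisor X.L) =
        ((0 : FinitePlace X.L →₀ ℤ), fun v => ((t v : NNReal) : ℝ)) := by
      refine Prod.ext (Finsupp.ext fun w => ?_) (funext fun v => ?_)
      · rw [EffArithDivisor.toArithDivisor_fst]; simp
      · rw [EffArithDivisor.toArithDivisor_snd]
    rw [e1, e2, arithDegree_inf, arithDegree_inf] at h1
    simp_rw [hm₁, hm₂, ← Finset.mul_sum] at h1
    have h2 : (∑ j, ((g t j : NNReal) : ℝ)) = ∑ i, ((t i : NNReal) : ℝ) :=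
      mul_left_cancel₀ (InfinitePlace.mult_coe_ne_zero (w := v₀)) h1
    exact_mod_cast h2
  obtain ⟨πi, hπi⟩ := NNRealPi.exists_equiv_map_single g
  have hgπ : ∀ (t : InfinitePlace X.L → NNReal) (v : InfinitePlace X.L), g t (πi v) = t v :=
    NNRealPi.apply_equiv_eq_of_sum_eq g πi hπi hsum
  -- structure of `eG`
  have hfin : ∀ (d : ArithDivisor X.L) (w : FinitePlace X.L), (eG d).1 (π w) = d.1 w := fun d w => by
    obtain ⟨D, D', rfl⟩ := ArithDivisor.exists_sub_eq X.L d
    rw [map_sub, heG, heG, heE_dec, heE_dec]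
    simp
  have harch : ∀ (d : ArithDivisor X.L) (v : InfinitePlace X.L), (eG d).2 (πi v) = d.2 v := fun d v => by
    obtain ⟨D, D', rfl⟩ := ArithDivisor.exists_sub_eq X.L d
    rw [map_sub, heG, heG, heE_dec, heE_dec]
    simp [hgπ]
  -- equivariance of `πi` (naturality of `Ψ^Φ` at the automorphisms of `X`)
  have hequiv : ∀ (h : X ⟶ X) (v : InfinitePlace X.L),
      πi (v.comap (h.toAlgHom : X.L →+* X.L)) =
        (πi v).comap ((ΨBase.map h).toAlgHom : (ΨBase.obj X).L →+* (ΨBase.obj X).L) := by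
    intro h v
    set v' := v.comap (h.toAlgHom : X.L →+* X.L) with hv'
    let D : EffArithDivisor X.L := (0, Pi.single v' 1)
    have hnat := E.natural h (Multiplicative.ofAdd D)
    have hnat' := congrArg (fun z => (Multiplicative.toAdd z).2 (πi v)) hnat
    simp only at hnat'
    -- left: `(Ψ^Φ (h^* D))(π_∞ v) = (h^* D)(v) = D(v ∘ h) = 1`
    have hl : (Multiplicative.toAdd (E.iso X ((arithFrobenioidOps F₁ K₁).pull h (Multiplicative.ofAdd D)))).2
        (πi v) = 1 := by
      change (eE (EffArithDivisor.pullback (h.toAlgHom : X.L →+* X.L) D)).2 (πi v) = 1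
      rw [heE_dec]
      change g (EffArithDivisor.pullback (h.toAlgHom : X.L →+* X.L) D).2 (πi v) = 1
      rw [hgπ, EffArithDivisor.pullback_snd]
      simp [D, hv']
    -- right: `((Ψ^Base h)^* (Ψ^Φ D))(π_∞ v) = (Ψ^Φ D)((π_∞ v) ∘ Ψ^Base h) = D(π_∞⁻¹ ((π_∞ v) ∘ Ψ^Base h))`
    have hr : (Multiplicative.toAdd ((arithFrobenioidOps F₂ K₂).pull (ΨBase.map h)
        (E.iso X (Multiplicative.ofAdd D)))).2 (πi v) =
          (Pi.single v' (1 : NNReal) : InfinitePlace X.L → NNReal)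
            (πi.symm ((πi v).comap ((ΨBase.map h).toAlgHom : (ΨBase.obj X).L →+* (ΨBase.obj X).L))) := by
      change (EffArithDivisor.pullback ((ΨBase.map h).toAlgHom : (ΨBase.obj X).L →+* (ΨBase.obj X).L)
        (eE D)).2 (πi v) = _
      rw [EffArithDivisor.pullback_snd, heE_dec]
      change g (Pi.single v' 1) _ = _
      conv_lhs => rw [← Equiv.apply_symm_apply πi
        ((πi v).comap ((ΨBase.map h).toAlgHom : (ΨBase.obj X).L →+* (ΨBase.obj X).L))]
      rw [hgπ]
    rw [hl, hr] at hnat'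
    have hv'' : πi.symm ((πi v).comap ((ΨBase.map h).toAlgHom : (ΨBase.obj X).L →+* (ΨBase.obj X).L)) = v' := by
      by_contra hne
      rw [Pi.single_eq_of_ne hne] at hnat'
      exact one_ne_zero hnat'
    exact (πi.symm_apply_eq.mp hv'').symm
  refine ⟨π, πi, eG, hπ, fun D v => ?_, hequiv, heG, hfin, harch, hprinc⟩
  change (eE D).2 (πi v) = D.2 v
  rw [heE_dec]
  exact hgπ D.2 v

/-- **Archimedean rigidity AT THE CONSTRUCTIONS**: for any field isomorphism `e : L₁ ≅ L₂`, the equivariant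
bijection `π_∞` of `arith_archTransport`, read on `L₁` through `e`, is induced by an element of `Gal(L₁/ℚ)`:
`(π_∞ v) ∘ e = s • v` for all infinite places `v` of `L₁`. [cite: MochizukiFrdI2008, Thm. 6.4 (iv) p.115] -/
theorem arith_archTransport_galois (Ψ : arithFrobenioid F₁ K₁ ≌ arithFrobenioid F₂ K₂)
    {ΨBase : FinSubextCat F₁ K₁ ⥤ FinSubextCat F₂ K₂} [ΨBase.IsEquivalence]
    (E : PreFrobenioidData.DivisorMonoidIsoOverBase (arithFrobenioidOps F₁ K₁) (arithFrobenioidOps F₂ K₂) ΨBase)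
    (η : Ψ.functor ⋙ (arithFrobenioidOps F₂ K₂).base ≅ (arithFrobenioidOps F₁ K₁).base ⋙ ΨBase)
    (hdiv : ∀ ⦃A B : arithFrobenioid F₁ K₁⦄ (φ : A ⟶ B),
      (arithFrobenioidOps F₂ K₂).div (Ψ.functor.map φ) =
        (arithFrobenioidOps F₂ K₂).pull (η.hom.app A)
          (E.iso ((arithFrobenioidOps F₁ K₁).base.obj A) ((arithFrobenioidOps F₁ K₁).div φ)))
    (X : FinSubextCat F₁ K₁) (hX : IsGalois ℚ X.L) (e : X.L ≃+* (ΨBase.obj X).L) :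
    ∃ (πi : InfinitePlace X.L ≃ InfinitePlace (ΨBase.obj X).L) (s : X.L ≃ₐ[ℚ] X.L),
      (∀ (h : X ⟶ X) (v : InfinitePlace X.L),
        πi (v.comap (h.toAlgHom : X.L →+* X.L)) =
          (πi v).comap ((ΨBase.map h).toAlgHom : (ΨBase.obj X).L →+* (ΨBase.obj X).L)) ∧
      ∀ v : InfinitePlace X.L, (πi v).comap (e : X.L →+* (ΨBase.obj X).L) = s • v := by
  classical
  haveI := hX
  obtain ⟨π, πi, eG, -, -, hequiv, -, hfin, harch, hprinc⟩ := arith_archTransport Ψ E η hdiv X hX e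
  -- transport `eG` back to `L₁` along `e`
  let σ : (ΨBase.obj X).L →+* X.L := (e.symm : (ΨBase.obj X).L →+* X.L)
  let Γ : ArithDivisor X.L →+ ArithDivisor X.L := (ArithDivisor.pullback σ).comp eG
  -- the place permutations of `Γ`
  have heσ : ((e : X.L →+* (ΨBase.obj X).L).comp σ) = RingHom.id (ΨBase.obj X).L := by
    ext x; simp [σ]
  have hσe : (σ.comp (e : X.L →+* (ΨBase.obj X).L)) = RingHom.id X.L := by
    ext x; simp [σ]
  have hunder : ∀ w : FinitePlace (ΨBase.obj X).L,
      ArithPullback.underPlace σ (ArithPullback.underPlace (e : X.L →+* (ΨBase.obj X).L) w) = w := fun w => by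
    rw [← ArithPullback.underPlace_comp, heσ, ArithPullback.underPlace_id]
  have hunder' : ∀ w : FinitePlace X.L,
      ArithPullback.underPlace (e : X.L →+* (ΨBase.obj X).L) (ArithPullback.underPlace σ w) = w := fun w => by
    rw [← ArithPullback.underPlace_comp, hσe, ArithPullback.underPlace_id]
  have hram : ∀ w : FinitePlace X.L, ArithPullback.ramIdxPlace σ w = 1 := fun w => by
    have h1 := ArithPullback.ramIdxPlace_comp (e : X.L →+* (ΨBase.obj X).L) σ w
    rw [hσe, ArithPullback.ramIdxPlace_id] at h1
    exact Nat.eq_one_of_mul_eq_one_left h1.symm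
  let ρf : FinitePlace X.L ≃ FinitePlace X.L :=
    { toFun := fun w => ArithPullback.underPlace (e : X.L →+* (ΨBase.obj X).L) (π w)
      invFun := fun w => π.symm (ArithPullback.underPlace σ w)
      left_inv := fun w => by simp [hunder]
      right_inv := fun w => by simp [hunder'] }
  let ρi : InfinitePlace X.L ≃ InfinitePlace X.L :=
    { toFun := fun v => (πi v).comap (e : X.L →+* (ΨBase.obj X).L)
      invFun := fun v => πi.symm (v.comap σ)
      left_inv := fun v => by
        simp only
        rw [← InfinitePlace.comap_comp, heσ, InfinitePlace.comap_id, Equiv.symm_apply_apply]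
      right_inv := fun v => by
        simp only
        rw [Equiv.apply_symm_apply, ← InfinitePlace.comap_comp, hσe, InfinitePlace.comap_id] }
  have hΓfin : ∀ (d : ArithDivisor X.L) (w : FinitePlace X.L), (Γ d).1 (ρf w) = d.1 w := fun d w => by
    change (ArithDivisor.pullback σ (eG d)).1 (ArithPullback.underPlace (e : X.L →+* (ΨBase.obj X).L) (π w)) = _
    rw [ArithDivisor.pullback_fst, hram, hunder, hfin, Nat.cast_one, one_mul]
  have hΓarch : ∀ (d : ArithDivisor X.L) (v : InfinitePlace X.L), (Γ d).2 (ρi v) = d.2 v := fun d v => by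
    change (ArithDivisor.pullback σ (eG d)).2 ((πi v).comap (e : X.L →+* (ΨBase.obj X).L)) = _
    rw [ArithDivisor.pullback_snd, ← InfinitePlace.comap_comp, heσ, InfinitePlace.comap_id, harch]
  have hΓprinc : ∀ x : (X.L)ˣ, ∃ y : (X.L)ˣ, Γ (principalArithDivisor X.L x) = principalArithDivisor X.L y := by
    intro x
    obtain ⟨y, hy⟩ := hprinc x
    refine ⟨Units.map (σ : (ΨBase.obj X).L →* X.L) y, ?_⟩
    change ArithDivisor.pullback σ (eG (principalArithDivisor X.L x)) = _
    rw [hy, ArithDivisor.pullback_principalArithDivisor]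
  obtain ⟨s, hs⟩ := exists_algEquiv_forall_eq_smul Γ ρf ρi hΓfin hΓarch hΓprinc
  exact ⟨πi, s, hequiv, hs⟩

end Arith

end Literature.AlgebraicGeometry.Frobenioids

end
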